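import Literature.Probability.LatticeModels.WeightedTreeBound
import HarnessLib

/-!
# Deviation from Wick's law, tree-diagram form — I: the random-current estimates

Topic `Literature/Probability/LatticeModels`. Random-current inequalities (edge-dependent couplings
`K ≥ 0` on a finite simple graph, `ℝ≥0∞` current sums `Z[A] = ecurrentSum K A`) behind the tree-diagram
form of Aizenman's bound on the deviation of the `2n`-point function from Wick's law
(Aizenman 1982, Prop. 12.1 with the tree diagram bound Prop. 5.3 / CDM 2020 (8.2); Panis 2023, Prop. 4.6
and §4.2), proved here directly by the switching lemma:

* `ecurrentSum_mul_empty_le_sum` — the Gaussian step `Z[B]Z[∅] ≤ ∑_{y∈B∖v} Z[{v}Δ{y}] Z[BΔ{v}Δ{y}]`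
  (one switching + handshake parity), weighted form of `currentSum_mul_currentSum_empty_le`;
* `cluster_decomposition_sources` — conditioning on the cluster of `x` for a first current with ARBITRARY
  sources (the involution of `cluster_decomposition` never looks at them);
* `treeBound_sources` — the tree-diagram mechanism with a many-source first current:
  `(∑ 1{∂n₁=A}1{∂n₂={z,t}} w w 1{z ∈ C_{n₁+n₂}(x)}) Z[∅]² ≤ ∑_u Z[{z,u}]Z[{t,u}] b(u)`,
  `b(u) = ∑ 1{∂n₁=A}1{∂n₂=∅} w w 1{u ∈ C_{n₁+n₂}(x)}` (verbatim the proof of `treeBound_currentSum`);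
* `manySource_treeBound` — `b(u) Z[∅] ≤ Z[{x,u}] ∑_{y∈A∖x} Z[{u,y}] Z[AΔ{x,y}]` (switching + Gaussian step), whence
  `P Z[∅]³ ≤ ∑_u ∑_{y∈A∖x} Z[zu]Z[tu]Z[xu]Z[uy] Z[AΔ{x,y}]`;
* `three_mul_gaussianDefect_le` — for `y₁ ∈ Y`:
  `3(∑_{j∈Y∖y₁} Z[y₁j]Z[YΔ{y₁,j}]) Z[∅]³ ≤ 3 Z[Y]Z[∅]⁴ + 2 ∑_{t⊆Y∖y₁,|t|=2} ∑_{y∈Y∖y₁∖t} ∑_u (∏_{i∈{y₁,y}∪t} Z[iu]) Z[Y∖({y₁,y}∪t)]`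
  — the excess of the Gaussian step over `Z[Y]Z[∅]` counts `N-1`, `N` = number of other sources in the
  cluster of `y₁`, which is ODD, so `3(N-1) ≤ N(N-1) = 2·C(N,2)`; each pair `{k,l}` of such sources is switched
  into a second current with sources `{k,l}` and estimated by `manySource_treeBound`.

The algebra turning these into `|S_{2n} - G_{2n}| ≤ 2 ∑_s T(x_s) G_{2n-4}(x_{s̸})` is in the sibling file
`TreeGraphWickBound.lean`.

## References

* M. Aizenman, *Geometric analysis of φ⁴ fields and Ising models*, Comm. Math. Phys. 86 (1982) 1–48,
  Prop. 5.3 (tree diagram bound), Prop. 12.1 (deviation from the Gaussian component) [AizenmanCMP1982].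
* M. Aizenman, CDM 2020, arXiv:2112.04248, Prop. 7.2 and Lemma 8.1 / (8.2) [AizenmanCDM2020] (read).
* R. Panis, arXiv:2309.05797 (2023), §4.1 (Lemma 4.4), §4.2 (Prop. 4.6, Prop. 4.7, tree diagram bound)
  [Panis2023Triviality] (read pp. 19–20).
* D. Brydges, J. Fröhlich, A. Sokal, Comm. Math. Phys. 91 (1983) 117–139, §4, (4.5) and (4.13)–(4.15)
  (random-walk analogues; Remark p. 129 on Aizenman's constant `3/2`) [BrydgesFrohlichSokal1983] (read).
-/

noncomputable section

open Finset Filter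
open scoped symmDiff ENNReal

namespace Literature.Probability.LatticeModels

variable {V : Type*} [Fintype V] [DecidableEq V] {G : SimpleGraph V} [DecidableRel G.Adj]

namespace Current

variable {K : G.edgeFinset → ℝ}

/-! ### Switching one pair of sources and the Gaussian step -/

/-- `∑ 1{∂n₁ = A} 1{∂n₂ = ∅} w w 1{u ∈ C_{n₁+n₂}(x)} = Z[A Δ {x} Δ {u}] · Z[{x} Δ {u}]` (one switching;
`u = x` allowed). [cite: Panis2023Triviality, Lemma 4.4] -/
theorem tsum_epairWeight_empty_mul_indicator (hK : ∀ e, 0 ≤ K e) (A : Finset V) (x u : V) :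
    ∑' p : Current G × Current G, epairWeight K A ∅ p * (if u ∈ (p.1 + p.2).cluster x then 1 else 0) =
      ecurrentSum K (A ∆ ({x} ∆ {u})) * ecurrentSum K ({x} ∆ {u}) := by
  have h := tsum_epairWeight_switch_pair hK A x u (fun _ => 1)
  simp only [one_mul, mul_one] at h
  rw [← h, tsum_epairWeight]

/-- **The Gaussian step for edge-dependent couplings** (Newman 1975; Aizenman 1982): for `K ≥ 0` and a
source set `B ∋ v`, `Z[B] Z[∅] ≤ ∑_{y ∈ B∖{v}} Z[{v}Δ{y}] Z[B Δ {v} Δ {y}]` — in a current with sources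
`B` the source `v` is connected to another source (`exists_source_reachable`), and each event `v ↔ y` is
switched into a pair of sources `{v,y}`. Weighted form of `currentSum_mul_currentSum_empty_le`.
[cite: AizenmanDuminilCopinAnnals2021, arXiv:1912.07973 §6.3, first display, lower inequality (p. 26)] -/
theorem ecurrentSum_mul_empty_le_sum (hK : ∀ e, 0 ≤ K e) (B : Finset V) {v : V} (hv : v ∈ B) :
    ecurrentSum K B * ecurrentSum K ∅ ≤
      ∑ y ∈ B.erase v, ecurrentSum K ({v} ∆ {y}) * ecurrentSum K (B ∆ ({v} ∆ {y})) := by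
  have hterm : ∀ y, ecurrentSum K ({v} ∆ {y}) * ecurrentSum K (B ∆ ({v} ∆ {y})) =
      ∑' p : Current G × Current G, epairWeight K B ∅ p * (if y ∈ (p.1 + p.2).cluster v then 1 else 0) := by
    intro y
    rw [tsum_epairWeight_empty_mul_indicator hK B v y, mul_comm]
  rw [← tsum_epairWeight K B ∅]
  simp_rw [hterm]
  rw [← Summable.tsum_finsetSum (fun _ _ => ENNReal.summable)]
  refine ENNReal.tsum_le_tsum fun p => ?_
  rw [← Finset.mul_sum]
  by_cases hp : p.1.sources = B ∧ p.2.sources = ∅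
  · obtain ⟨y, hyB, hyv, hreach⟩ := exists_source_reachable G p.1 (x := v) (hp.1 ▸ hv)
    have hy : y ∈ B.erase v := Finset.mem_erase.mpr ⟨hyv, hp.1 ▸ hyB⟩
    have hyC : y ∈ (p.1 + p.2).cluster v :=
      cluster_mono (self_le_add_right p.1 p.2) v (mem_cluster_iff.2 hreach)
    calc epairWeight K B ∅ p = epairWeight K B ∅ p * 1 := (mul_one _).symm
      _ ≤ epairWeight K B ∅ p * ∑ y ∈ B.erase v, (if y ∈ (p.1 + p.2).cluster v then 1 else 0) := by
          refine mul_le_mul' le_rfl ?_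
          calc (1 : ℝ≥0∞) = (if y ∈ (p.1 + p.2).cluster v then 1 else 0) := by rw [if_pos hyC]
            _ ≤ ∑ y ∈ B.erase v, (if y ∈ (p.1 + p.2).cluster v then 1 else 0) :=
                Finset.single_le_sum (f := fun y => if y ∈ (p.1 + p.2).cluster v then (1 : ℝ≥0∞) else 0)
                  (fun _ _ => bot_le) hy
  · simp only [epairWeight, if_neg hp, zero_mul, le_refl]

/-! ### Conditioning on the cluster of `x`, arbitrary sources of the first current -/

/-- **Conditioning on the cluster of `x`** for a first current with arbitrary sources `A` (the involution
of `cluster_decomposition` — `((n₁,n₂),k) ↦ ((n₁, spliceOff S n₂ k), spliceOff S k n₂)` — does not involve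
the sources of `n₁`): for `K ≥ 0`, a vertex set `S` and `z, t ∉ S`,
`(∑ 1{∂n₁=A} 1{∂n₂={z,t}} w w 1{C_{n₁+n₂}(x)=S}) · Z_{S^c}[∅] = (∑ 1{∂n₁=A} 1{∂n₂=∅} w w 1{C_{n₁+n₂}(x)=S}) · Z_{S^c}[{z,t}]`.
[cite: Panis2023Triviality, §4.2] -/
theorem cluster_decomposition_sources (hK : ∀ e, 0 ≤ K e) (A : Finset V) {S : Finset V} {x z t : V}
    (hz : z ∉ S) (ht : t ∉ S) :
    (∑' p : Current G × Current G, epairWeight K A ({z} ∆ {t}) p *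
        (if (p.1 + p.2).cluster x = S then 1 else 0)) * ecurrentSumIn (offGraph G S) K ∅ =
      (∑' p : Current G × Current G, epairWeight K A ∅ p *
        (if (p.1 + p.2).cluster x = S then 1 else 0)) * ecurrentSumIn (offGraph G S) K ({z} ∆ {t}) := by
  have hzt_in : (({z} : Finset V) ∆ {t}).filter (· ∈ S) = ∅ :=
    Finset.filter_false_of_mem fun v hv hvS => by
      rcases eq_or_eq_of_mem_symmDiff_singleton hv with rfl | rfl
      · exact hz hvS
      · exact ht hvS
  have hzt_out : (({z} : Finset V) ∆ {t}).filter (· ∉ S) = {z} ∆ {t} :=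
    Finset.filter_true_of_mem fun v hv hvS => by
      rcases eq_or_eq_of_mem_symmDiff_singleton hv with rfl | rfl
      · exact hz hvS
      · exact ht hvS
  set FA : (Current G × Current G) × Current G → ℝ≥0∞ := fun q =>
    epairWeight K A ({z} ∆ {t}) q.1 * (if (q.1.1 + q.1.2).cluster x = S then 1 else 0) *
      (if IsSupp (offGraph G S) q.2 ∧ q.2.sources = ∅ then q.2.eweight K else 0) with hFA
  set FB : (Current G × Current G) × Current G → ℝ≥0∞ := fun q =>
    epairWeight K A ∅ q.1 * (if (q.1.1 + q.1.2).cluster x = S then 1 else 0) *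
      (if IsSupp (offGraph G S) q.2 ∧ q.2.sources = {z} ∆ {t} then q.2.eweight K else 0) with hFB
  have hL : (∑' p : Current G × Current G, epairWeight K A ({z} ∆ {t}) p *
      (if (p.1 + p.2).cluster x = S then 1 else 0)) * ecurrentSumIn (offGraph G S) K ∅ = ∑' q, FA q := by
    rw [ecurrentSumIn, tsum_mul_tsum_eq_tsum_prod]
  have hR : (∑' p : Current G × Current G, epairWeight K A ∅ p *
      (if (p.1 + p.2).cluster x = S then 1 else 0)) * ecurrentSumIn (offGraph G S) K ({z} ∆ {t}) =
      ∑' q, FB q := by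
    rw [ecurrentSumIn, tsum_mul_tsum_eq_tsum_prod]
  rw [hL, hR]
  set f : (Current G × Current G) × Current G → (Current G × Current G) × Current G :=
    fun q => ((q.1.1, spliceOff S q.1.2 q.2), spliceOff S q.2 q.1.2) with hf
  have hinv : Function.Involutive f := by
    rintro ⟨⟨n₁, n₂⟩, k⟩
    simp only [hf, spliceOff_spliceOff]
  rw [← (hinv.toPerm f).tsum_eq FB]
  refine tsum_congr fun q => ?_
  obtain ⟨⟨n₁, n₂⟩, k⟩ := q
  change FA ((n₁, n₂), k) = FB ((n₁, spliceOff S n₂ k), spliceOff S k n₂)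
  simp only [hFA, hFB, epairWeight]
  by_cases hA : (n₁.sources = A ∧ n₂.sources = {z} ∆ {t}) ∧ (n₁ + n₂).cluster x = S ∧
      (IsSupp (offGraph G S) k ∧ k.sources = ∅)
  · obtain ⟨⟨h1, h2⟩, hC, hk, hk0⟩ := hA
    obtain ⟨hC', hk', hsk', hsn'⟩ := splice_transfer hC hk
    have hn2' : (spliceOff S n₂ k).sources = ∅ := by
      rw [hsn', h2, hk0, hzt_in, Finset.filter_empty, Finset.empty_union]
    have hk'' : (spliceOff S k n₂).sources = {z} ∆ {t} := by rw [hsk', h2, hzt_out]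
    rw [if_pos ⟨h1, h2⟩, if_pos hC, if_pos ⟨hk, hk0⟩, if_pos ⟨h1, hn2'⟩, if_pos hC', if_pos ⟨hk', hk''⟩,
      mul_one, mul_one, mul_assoc, mul_assoc, eweight_spliceOff_mul_eweight_spliceOff hK S n₂ k]
  · have hB : ¬ ((n₁.sources = A ∧ (spliceOff S n₂ k).sources = ∅) ∧
        (n₁ + spliceOff S n₂ k).cluster x = S ∧
        (IsSupp (offGraph G S) (spliceOff S k n₂) ∧ (spliceOff S k n₂).sources = {z} ∆ {t})) := by
      rintro ⟨⟨h1, h2'⟩, hC', hk', hk''⟩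
      obtain ⟨hC, hk, hsk, hsn⟩ := splice_transfer hC' hk'
      rw [spliceOff_spliceOff] at hC hk hsk hsn
      refine hA ⟨⟨h1, ?_⟩, hC, hk, ?_⟩
      · rw [hsn, h2', hk'', hzt_out, Finset.filter_empty, Finset.empty_union]
      · rw [hsk, h2', Finset.filter_empty]
    have hA0 : (if n₁.sources = A ∧ n₂.sources = {z} ∆ {t} then n₁.eweight K * n₂.eweight K else 0) *
        (if (n₁ + n₂).cluster x = S then (1 : ℝ≥0∞) else 0) *
        (if IsSupp (offGraph G S) k ∧ k.sources = ∅ then k.eweight K else 0) = 0 := by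
      by_cases h12 : n₁.sources = A ∧ n₂.sources = {z} ∆ {t}
      · by_cases hC : (n₁ + n₂).cluster x = S
        · have hk : ¬ (IsSupp (offGraph G S) k ∧ k.sources = ∅) := fun hk => hA ⟨h12, hC, hk⟩
          rw [if_neg hk, mul_zero]
        · rw [if_neg hC, mul_zero, zero_mul]
      · rw [if_neg h12, zero_mul, zero_mul]
    have hB0 : (if n₁.sources = A ∧ (spliceOff S n₂ k).sources = ∅ then
          n₁.eweight K * (spliceOff S n₂ k).eweight K else 0) *
        (if (n₁ + spliceOff S n₂ k).cluster x = S then (1 : ℝ≥0∞) else 0) *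
        (if IsSupp (offGraph G S) (spliceOff S k n₂) ∧ (spliceOff S k n₂).sources = {z} ∆ {t} then
          (spliceOff S k n₂).eweight K else 0) = 0 := by
      by_cases h12 : n₁.sources = A ∧ (spliceOff S n₂ k).sources = ∅
      · by_cases hC : (n₁ + spliceOff S n₂ k).cluster x = S
        · have hk : ¬ (IsSupp (offGraph G S) (spliceOff S k n₂) ∧ (spliceOff S k n₂).sources = {z} ∆ {t}) :=
            fun hk => hB ⟨h12, hC, hk⟩
          rw [if_neg hk, mul_zero]
        · rw [if_neg hC, mul_zero, zero_mul]
      · rw [if_neg h12, zero_mul, zero_mul]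
    rw [hA0, hB0]

/-! ### The tree-diagram mechanism with a many-source first current -/

/-- **The tree-diagram mechanism, arbitrary sources of the first current** (the proof of
`treeBound_currentSum`, verbatim, up to its last step): for `K ≥ 0`, a source set `A`, vertices `x, z, t`,
with `P = ∑ 1{∂n₁=A} 1{∂n₂={z,t}} w w 1{z ∈ C_{n₁+n₂}(x)}` and
`b(u) = ∑ 1{∂n₁=A} 1{∂n₂=∅} w w 1{u ∈ C_{n₁+n₂}(x)}`,
`P · Z[∅]² ≤ ∑_u Z[{z,u}] Z[{t,u}] b(u)` (conditioning on the cluster of `x`, the restricted two-point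
bound `restricted_pair_bound`, and `t ∈ C ⇒ z ∈ C`).
[cite: Panis2023Triviality, §4.2 (tree diagram bound, display after Proposition 4.7)] [cite: AizenmanCMP1982, Prop. 5.3] -/
theorem treeBound_sources (hK : ∀ e, 0 ≤ K e) (A : Finset V) (x z t : V) :
    (∑' p : Current G × Current G, epairWeight K A ({z} ∆ {t}) p *
        (if z ∈ (p.1 + p.2).cluster x then 1 else 0)) * ecurrentSum K ∅ ^ 2 ≤
      ∑ u, ecurrentSum K ({z} ∆ {u}) * ecurrentSum K ({t} ∆ {u}) *
        ∑' p : Current G × Current G, epairWeight K A ∅ p * (if u ∈ (p.1 + p.2).cluster x then 1 else 0) := by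
  -- notation
  set Z : Finset V → ℝ≥0∞ := fun A => ecurrentSum K A with hZ
  set E : Current G × Current G → ℝ≥0∞ := epairWeight K A ({z} ∆ {t}) with hE
  set E0 : Current G × Current G → ℝ≥0∞ := epairWeight K A ∅ with hE0
  set C : Current G × Current G → Finset V := fun p => (p.1 + p.2).cluster x with hC
  set c : V → ℝ≥0∞ := fun u => Z ({t} ∆ {u}) * Z ({z} ∆ {u}) with hc
  set 𝒮 : Finset (Finset V) := univ.filter fun S => z ∉ S ∧ t ∉ S with h𝒮
  set P : ℝ≥0∞ := ∑' p, E p * (if z ∈ C p then 1 else 0) with hP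
  set Q : ℝ≥0∞ := ∑' p, E p * (if z ∉ C p ∧ t ∉ C p then 1 else 0) with hQ
  set QS : Finset V → ℝ≥0∞ := fun S => ∑' p, E p * (if C p = S then 1 else 0) with hQS
  set aS : Finset V → ℝ≥0∞ := fun S => ∑' p, E0 p * (if C p = S then 1 else 0) with haS
  set A0 : ℝ≥0∞ := ∑' p, E0 p * (if z ∉ C p ∧ t ∉ C p then 1 else 0) with hA0
  set A1 : ℝ≥0∞ := ∑' p, E0 p * (if z ∈ C p ∨ t ∈ C p then 1 else 0) with hA1
  set b : V → ℝ≥0∞ := fun u => ∑' p, E0 p * (if u ∈ C p then 1 else 0) with hb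
  have hmem𝒮 : ∀ S, S ∈ 𝒮 ↔ z ∉ S ∧ t ∉ S := fun S => by simp [h𝒮]
  -- finiteness
  have hZtop : ∀ A, Z A ≠ ∞ := fun A => ecurrentSum_ne_top hK A
  have hEsum : ∑' p, E p = Z A * Z ({z} ∆ {t}) := tsum_epairWeight K _ _
  have hE0sum : ∑' p, E0 p = Z A * Z ∅ := tsum_epairWeight K _ _
  have hQle : Q ≤ ∑' p, E p := ENNReal.tsum_le_tsum fun p =>
    calc E p * (if z ∉ C p ∧ t ∉ C p then 1 else 0) ≤ E p * 1 := mul_le_mul' le_rfl (by split_ifs <;> simp)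
      _ = E p := mul_one _
  have hQtop : Q * Z ∅ ^ 2 ≠ ∞ := by
    refine ENNReal.mul_ne_top (ne_top_of_le_ne_top ?_ hQle) (ENNReal.pow_ne_top (hZtop ∅))
    rw [hEsum]; exact ENNReal.mul_ne_top (hZtop _) (hZtop _)
  -- (s1) `Z[A] Z[zt] = P + Q`
  have hs1 : Z A * Z ({z} ∆ {t}) = P + Q := by
    rw [← hEsum, hP, hQ, ← ENNReal.tsum_add]
    refine tsum_congr fun p => ?_
    rw [← mul_add]
    by_cases hp : p.1.sources = A ∧ p.2.sources = {z} ∆ {t}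
    · by_cases hzC : z ∈ C p
      · have : ¬ (z ∉ C p ∧ t ∉ C p) := fun h => h.1 hzC
        rw [if_pos hzC, if_neg this, add_zero, mul_one]
      · have htC : t ∉ C p := fun htC => hzC (mem_cluster_of_mem_cluster_of_sources_eq hp.2 htC)
        rw [if_neg hzC, if_pos ⟨hzC, htC⟩, zero_add, mul_one]
    · simp only [hE, epairWeight, if_neg hp, zero_mul]
  -- (s2) resolving the complementary events by the value of the cluster
  have hres : ∀ (F : Current G × Current G → ℝ≥0∞) (g : Finset V → ℝ≥0∞),
      ∑' p, F p * ((if z ∉ C p ∧ t ∉ C p then 1 else 0) * g (C p)) =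
        ∑ S ∈ 𝒮, ∑' p, F p * (if C p = S then 1 else 0) * g S := by
    intro F g
    rw [← Summable.tsum_finsetSum (fun _ _ => ENNReal.summable)]
    refine tsum_congr fun p => ?_
    have h1 : ∑ S ∈ 𝒮, F p * (if C p = S then 1 else 0) * g S =
        F p * ∑ S ∈ 𝒮, (if C p = S then g S else 0) := by
      rw [Finset.mul_sum]
      exact Finset.sum_congr rfl fun S _ => by split_ifs <;> simp
    rw [h1, Finset.sum_ite_eq]
    by_cases hCp : z ∉ C p ∧ t ∉ C p
    · rw [if_pos hCp, if_pos ((hmem𝒮 _).2 hCp), one_mul]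
    · rw [if_neg hCp, if_neg (fun h => hCp ((hmem𝒮 _).1 h)), zero_mul]
  have hQsum : Q = ∑ S ∈ 𝒮, QS S := by
    have h := hres E (fun _ => 1)
    simp only [mul_one] at h
    exact h
  have hA0sum : A0 = ∑ S ∈ 𝒮, aS S := by
    have h := hres E0 (fun _ => 1)
    simp only [mul_one] at h
    exact h
  -- (s3) the per-cluster inequality
  have hES : ∀ S ∈ 𝒮, aS S * Z ({z} ∆ {t}) * Z ∅ ≤ QS S * Z ∅ ^ 2 + aS S * ∑ u ∈ S, c u := by
    intro S hS
    obtain ⟨hzS, htS⟩ := (hmem𝒮 S).1 hS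
    have hne0 : ecurrentSumIn (offGraph G S) K ∅ ≠ 0 :=
      (lt_of_lt_of_le zero_lt_one (one_le_ecurrentSumIn_empty (offGraph G S) K)).ne'
    have hnetop : ecurrentSumIn (offGraph G S) K ∅ ≠ ∞ := ecurrentSumIn_ne_top (offGraph G S) hK ∅
    have hdec : QS S * ecurrentSumIn (offGraph G S) K ∅ = aS S * ecurrentSumIn (offGraph G S) K ({z} ∆ {t}) :=
      cluster_decomposition_sources hK A hzS htS
    have hrp := restricted_pair_bound hK S z t
    rw [← ENNReal.mul_le_mul_iff_right hne0 hnetop]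
    calc ecurrentSumIn (offGraph G S) K ∅ * (aS S * Z ({z} ∆ {t}) * Z ∅)
        = aS S * (ecurrentSumIn (offGraph G S) K ∅ * ecurrentSum K ({z} ∆ {t}) * ecurrentSum K ∅) := by
          simp only [hZ]; ring
      _ ≤ aS S * (ecurrentSumIn (offGraph G S) K ({z} ∆ {t}) * ecurrentSum K ∅ ^ 2 +
            ecurrentSumIn (offGraph G S) K ∅ * ∑ u ∈ S, ecurrentSum K ({t} ∆ {u}) * ecurrentSum K ({z} ∆ {u})) :=
          mul_le_mul' le_rfl hrp
      _ = (aS S * ecurrentSumIn (offGraph G S) K ({z} ∆ {t})) * Z ∅ ^ 2 +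
            ecurrentSumIn (offGraph G S) K ∅ * (aS S * ∑ u ∈ S, c u) := by simp only [hZ, hc]; ring
      _ = ecurrentSumIn (offGraph G S) K ∅ * (QS S * Z ∅ ^ 2 + aS S * ∑ u ∈ S, c u) := by rw [← hdec]; ring
  -- (s4) summed over the clusters
  have hs4 : A0 * Z ({z} ∆ {t}) * Z ∅ ≤ Q * Z ∅ ^ 2 + ∑ S ∈ 𝒮, aS S * ∑ u ∈ S, c u := by
    rw [hA0sum, hQsum, Finset.sum_mul, Finset.sum_mul, Finset.sum_mul, ← Finset.sum_add_distrib]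
    exact Finset.sum_le_sum hES
  -- (s5) the correction terms and the events `z ∈ C(x)`, `t ∈ C(x)` under `P^{A} ⊗ P^∅`
  have hcorr : ∑ S ∈ 𝒮, aS S * ∑ u ∈ S, c u = ∑' p, E0 p * ((if z ∉ C p ∧ t ∉ C p then 1 else 0) * ∑ u ∈ C p, c u) := by
    rw [hres E0 (fun S => ∑ u ∈ S, c u)]
    refine Finset.sum_congr rfl fun S _ => ?_
    rw [haS, ← ENNReal.tsum_mul_right]
  have hpt : ∀ p : Current G × Current G,
      (if z ∉ C p ∧ t ∉ C p then (1 : ℝ≥0∞) else 0) * (∑ u ∈ C p, c u) +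
          (if z ∈ C p ∨ t ∈ C p then 1 else 0) * (Z ({z} ∆ {t}) * Z ∅) ≤
        ∑ u, c u * (if u ∈ C p then 1 else 0) := by
    intro p
    have hsum : ∑ u ∈ C p, c u = ∑ u, c u * (if u ∈ C p then 1 else 0) := (sum_mul_ite_mem_eq (C p) c).symm
    by_cases hCp : z ∉ C p ∧ t ∉ C p
    · have : ¬ (z ∈ C p ∨ t ∈ C p) := fun h => h.elim hCp.1 hCp.2
      rw [if_pos hCp, if_neg this, one_mul, zero_mul, add_zero, hsum]
    · have hor : z ∈ C p ∨ t ∈ C p := by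
        by_contra h; exact hCp ⟨fun hz => h (Or.inl hz), fun ht => h (Or.inr ht)⟩
      rw [if_neg hCp, if_pos hor, zero_mul, zero_add, one_mul]
      rcases hor with hzC | htC
      · calc Z ({z} ∆ {t}) * Z ∅ = c z * (if z ∈ C p then 1 else 0) := by
              rw [if_pos hzC, mul_one, hc]
              simp only [symmDiff_self, Finset.bot_eq_empty, symmDiff_comm]
          _ ≤ ∑ u, c u * (if u ∈ C p then 1 else 0) :=
              Finset.single_le_sum (f := fun u => c u * (if u ∈ C p then 1 else 0)) (fun _ _ => bot_le)
                (Finset.mem_univ z)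
      · calc Z ({z} ∆ {t}) * Z ∅ = c t * (if t ∈ C p then 1 else 0) := by
              rw [if_pos htC, mul_one, hc]
              simp only [symmDiff_self, Finset.bot_eq_empty, mul_comm]
          _ ≤ ∑ u, c u * (if u ∈ C p then 1 else 0) :=
              Finset.single_le_sum (f := fun u => c u * (if u ∈ C p then 1 else 0)) (fun _ _ => bot_le)
                (Finset.mem_univ t)
  have hs5 : ∑ S ∈ 𝒮, aS S * ∑ u ∈ S, c u + A1 * (Z ({z} ∆ {t}) * Z ∅) ≤ ∑ u, c u * b u := by
    have hb' : ∑ u, c u * b u = ∑' p, E0 p * ∑ u, c u * (if u ∈ C p then 1 else 0) := by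
      simp only [hb]
      rw [Finset.sum_congr rfl fun u _ => (ENNReal.tsum_mul_left (a := c u)).symm,
        ← Summable.tsum_finsetSum (fun _ _ => ENNReal.summable)]
      refine tsum_congr fun p => ?_
      rw [Finset.mul_sum]
      exact Finset.sum_congr rfl fun u _ => by ring
    rw [hcorr, hA1, ← ENNReal.tsum_mul_right, ← ENNReal.tsum_add, hb']
    refine ENNReal.tsum_le_tsum fun p => ?_
    rw [mul_assoc, ← mul_add]
    exact mul_le_mul' le_rfl (hpt p)
  -- (s6) `A1 + A0 = Z[A] Z[∅]`
  have hs6 : A1 + A0 = Z A * Z ∅ := by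
    rw [← hE0sum, hA1, hA0, ← ENNReal.tsum_add]
    refine tsum_congr fun p => ?_
    rw [← mul_add]
    by_cases hCp : z ∈ C p ∨ t ∈ C p
    · have : ¬ (z ∉ C p ∧ t ∉ C p) := fun h => hCp.elim h.1 h.2
      rw [if_pos hCp, if_neg this, add_zero, mul_one]
    · have : z ∉ C p ∧ t ∉ C p := ⟨fun hz => hCp (Or.inl hz), fun ht => hCp (Or.inr ht)⟩
      rw [if_neg hCp, if_pos this, zero_add, mul_one]
  -- (s7) conclusion
  have key : P * Z ∅ ^ 2 + Q * Z ∅ ^ 2 ≤ ∑ u, c u * b u + Q * Z ∅ ^ 2 :=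
    calc P * Z ∅ ^ 2 + Q * Z ∅ ^ 2 = (A1 + A0) * Z ({z} ∆ {t}) * Z ∅ := by
          rw [hs6, ← add_mul, ← hs1]; ring
      _ = A1 * (Z ({z} ∆ {t}) * Z ∅) + A0 * Z ({z} ∆ {t}) * Z ∅ := by ring
      _ ≤ A1 * (Z ({z} ∆ {t}) * Z ∅) + (Q * Z ∅ ^ 2 + ∑ S ∈ 𝒮, aS S * ∑ u ∈ S, c u) :=
          add_le_add le_rfl hs4
      _ = (∑ S ∈ 𝒮, aS S * ∑ u ∈ S, c u + A1 * (Z ({z} ∆ {t}) * Z ∅)) + Q * Z ∅ ^ 2 := by ring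
      _ ≤ ∑ u, c u * b u + Q * Z ∅ ^ 2 := add_le_add hs5 le_rfl
  have key' : P * Z ∅ ^ 2 ≤ ∑ u, c u * b u := (ENNReal.add_le_add_iff_right hQtop).1 key
  refine key'.trans (le_of_eq (Finset.sum_congr rfl fun u _ => ?_))
  simp only [hc, hb, hZ]
  ring

omit [Fintype V] in
/-- `{x} Δ {u} Δ ({u} Δ {y}) = {x} Δ {y}`. [folklore] -/
theorem pair_symmDiff_pair_cancel (x u y : V) :
    (({x} : Finset V) ∆ {u}) ∆ ({u} ∆ {y}) = {x} ∆ {y} := by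
  rw [symmDiff_assoc, symmDiff_symmDiff_cancel_left]

/-- **Switching plus the Gaussian step** on `b(u) = Z[AΔ{x}Δ{u}] Z[{x,u}]`: for `x ∈ A`,
`Z[AΔ{x}Δ{u}] Z[{x}Δ{u}] Z[∅] ≤ Z[{x}Δ{u}] ∑_{y ∈ A∖x} Z[{u}Δ{y}] Z[AΔ{x}Δ{y}]` (for `u ∈ A∖x` the left side is
the `y = u` term; otherwise `u ∈ AΔ{x}Δ{u}` is paired off by `ecurrentSum_mul_empty_le_sum`). [cite: AizenmanCMP1982, Prop. 12.1 (Gaussian step)] -/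
theorem switch_gaussian_step (hK : ∀ e, 0 ≤ K e) {A : Finset V} {x : V} (hx : x ∈ A) (u : V) :
    ecurrentSum K (A ∆ ({x} ∆ {u})) * ecurrentSum K ({x} ∆ {u}) * ecurrentSum K ∅ ≤
      ecurrentSum K ({x} ∆ {u}) *
        ∑ y ∈ A.erase x, ecurrentSum K ({u} ∆ {y}) * ecurrentSum K (A ∆ ({x} ∆ {y})) := by
  by_cases hu : u ∈ A.erase x
  · -- the `y = u` term alone
    calc ecurrentSum K (A ∆ ({x} ∆ {u})) * ecurrentSum K ({x} ∆ {u}) * ecurrentSum K ∅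
        = ecurrentSum K ({x} ∆ {u}) * (ecurrentSum K ({u} ∆ {u}) * ecurrentSum K (A ∆ ({x} ∆ {u}))) := by
          rw [symmDiff_self, Finset.bot_eq_empty]; ring
      _ ≤ ecurrentSum K ({x} ∆ {u}) *
            ∑ y ∈ A.erase x, ecurrentSum K ({u} ∆ {y}) * ecurrentSum K (A ∆ ({x} ∆ {y})) :=
          mul_le_mul' le_rfl
            (Finset.single_le_sum (f := fun y => ecurrentSum K ({u} ∆ {y}) * ecurrentSum K (A ∆ ({x} ∆ {y})))
              (fun _ _ => bot_le) hu)
  · -- `u = x` or `u ∉ A`: `u` is a source of `B = A Δ {x} Δ {u}`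
    have hu' : u = x ∨ u ∉ A := by
      by_contra h
      push Not at h
      exact hu (Finset.mem_erase.2 ⟨h.1, h.2⟩)
    set B : Finset V := A ∆ ({x} ∆ {u}) with hB
    have huB : u ∈ B := by
      rcases hu' with rfl | huA
      · rw [hB, symmDiff_self, symmDiff_bot]; exact hx
      · have hux : u ≠ x := fun h => huA (h ▸ hx)
        rw [hB, Finset.mem_symmDiff]
        refine Or.inr ⟨?_, huA⟩
        rw [Finset.mem_symmDiff, Finset.mem_singleton, Finset.mem_singleton]
        exact Or.inr ⟨rfl, hux⟩
    have hBerase : B.erase u = A.erase x := by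
      rcases hu' with rfl | huA
      · rw [hB, symmDiff_self, symmDiff_bot]
      · have hux : u ≠ x := fun h => huA (h ▸ hx)
        ext w
        simp only [hB, Finset.mem_erase, Finset.mem_symmDiff, Finset.mem_singleton]
        constructor
        · rintro ⟨hwu, h | h⟩
          · refine ⟨fun hwx => ?_, h.1⟩
            exact h.2 (Or.inl ⟨hwx, fun hwu' => hwu hwu'⟩)
          · rcases h.1 with ⟨hwx, -⟩ | ⟨hwu', -⟩
            · exact absurd (hwx ▸ hx) h.2
            · exact absurd hwu' hwu
        · rintro ⟨hwx, hwA⟩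
          have hwu : w ≠ u := fun h => huA (h ▸ hwA)
          exact ⟨hwu, Or.inl ⟨hwA, fun h => h.elim (fun h1 => hwx h1.1) (fun h2 => hwu h2.1)⟩⟩
    have hBy : ∀ y, B ∆ ({u} ∆ {y}) = A ∆ ({x} ∆ {y}) := fun y => by
      rw [hB, symmDiff_assoc, pair_symmDiff_pair_cancel]
    have hg := ecurrentSum_mul_empty_le_sum hK B huB
    rw [hBerase] at hg
    simp_rw [hBy] at hg
    calc ecurrentSum K B * ecurrentSum K ({x} ∆ {u}) * ecurrentSum K ∅
        = ecurrentSum K ({x} ∆ {u}) * (ecurrentSum K B * ecurrentSum K ∅) := by ring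
      _ ≤ _ := mul_le_mul' le_rfl hg

/-- **The many-source tree diagram bound** (the tree-diagram mechanism of Aizenman 1982, Prop. 5.3 /
Panis 2023 §4.2, with a first current of sources `A ∋ x`, followed by one switching and the Gaussian step):
for `K ≥ 0`, `x ∈ A` and vertices `z, t`,
`(∑ 1{∂n₁=A} 1{∂n₂={z,t}} w w 1{z ∈ C_{n₁+n₂}(x)}) · Z[∅]³
   ≤ ∑_u ∑_{y∈A∖x} Z[{z,u}] Z[{t,u}] Z[{x,u}] Z[{u,y}] Z[A Δ {x} Δ {y}]`.
[cite: AizenmanCMP1982, Prop. 5.3 and Prop. 12.1] [cite: Panis2023Triviality, §4.2 (tree diagram bound)] -/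
theorem manySource_treeBound (hK : ∀ e, 0 ≤ K e) {A : Finset V} {x : V} (hx : x ∈ A) (z t : V) :
    (∑' p : Current G × Current G, epairWeight K A ({z} ∆ {t}) p *
        (if z ∈ (p.1 + p.2).cluster x then 1 else 0)) * ecurrentSum K ∅ ^ 3 ≤
      ∑ u, ∑ y ∈ A.erase x, ecurrentSum K ({z} ∆ {u}) * ecurrentSum K ({t} ∆ {u}) *
        ecurrentSum K ({x} ∆ {u}) * (ecurrentSum K ({u} ∆ {y}) * ecurrentSum K (A ∆ ({x} ∆ {y}))) := by
  have h1 := treeBound_sources hK A x z t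
  have hb : ∀ u, (∑' p : Current G × Current G, epairWeight K A ∅ p *
      (if u ∈ (p.1 + p.2).cluster x then 1 else 0)) * ecurrentSum K ∅ ≤
      ecurrentSum K ({x} ∆ {u}) *
        ∑ y ∈ A.erase x, ecurrentSum K ({u} ∆ {y}) * ecurrentSum K (A ∆ ({x} ∆ {y})) := fun u => by
    rw [tsum_epairWeight_empty_mul_indicator hK A x u]
    exact switch_gaussian_step hK hx u
  calc (∑' p : Current G × Current G, epairWeight K A ({z} ∆ {t}) p *
        (if z ∈ (p.1 + p.2).cluster x then 1 else 0)) * ecurrentSum K ∅ ^ 3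
      = (∑' p : Current G × Current G, epairWeight K A ({z} ∆ {t}) p *
          (if z ∈ (p.1 + p.2).cluster x then 1 else 0)) * ecurrentSum K ∅ ^ 2 * ecurrentSum K ∅ := by ring
    _ ≤ (∑ u, ecurrentSum K ({z} ∆ {u}) * ecurrentSum K ({t} ∆ {u}) *
          ∑' p : Current G × Current G, epairWeight K A ∅ p * (if u ∈ (p.1 + p.2).cluster x then 1 else 0)) *
          ecurrentSum K ∅ := mul_le_mul' h1 le_rfl
    _ = ∑ u, ecurrentSum K ({z} ∆ {u}) * ecurrentSum K ({t} ∆ {u}) *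
          ((∑' p : Current G × Current G, epairWeight K A ∅ p * (if u ∈ (p.1 + p.2).cluster x then 1 else 0)) *
            ecurrentSum K ∅) := by
        rw [Finset.sum_mul]
        exact Finset.sum_congr rfl fun u _ => by ring
    _ ≤ ∑ u, ecurrentSum K ({z} ∆ {u}) * ecurrentSum K ({t} ∆ {u}) *
          (ecurrentSum K ({x} ∆ {u}) *
            ∑ y ∈ A.erase x, ecurrentSum K ({u} ∆ {y}) * ecurrentSum K (A ∆ ({x} ∆ {y}))) :=
        Finset.sum_le_sum fun u _ => mul_le_mul' le_rfl (hb u)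
    _ = _ := by
        refine Finset.sum_congr rfl fun u _ => ?_
        rw [Finset.mul_sum, Finset.mul_sum]
        exact Finset.sum_congr rfl fun y _ => by ring

/-! ### The excess in the Gaussian step: pairs of extra sources in the cluster -/

omit [Fintype V] in
/-- The combinatorial heart: if `N = #(S ∩ C)` is odd then `3N ≤ 3 + N(N-1)`, i.e.
`3 ∑_{j∈S} 1{j∈C} ≤ 3 + ∑_{k∈S} ∑_{l∈S∖k} 1{k∈C}1{l∈C}` (in `ℝ≥0∞`). [folklore] -/
theorem three_mul_sum_indicator_le {S C : Finset V} (hodd : Odd #(S.filter (· ∈ C))) :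
    3 * ∑ j ∈ S, (if j ∈ C then (1 : ℝ≥0∞) else 0) ≤
      3 + ∑ k ∈ S, ∑ l ∈ S.erase k, (if k ∈ C then (1 : ℝ≥0∞) else 0) * (if l ∈ C then 1 else 0) := by
  set F : Finset V := S.filter (· ∈ C) with hF
  set N : ℕ := #F with hN
  have h1 : ∑ j ∈ S, (if j ∈ C then (1 : ℝ≥0∞) else 0) = (N : ℝ≥0∞) := by
    rw [Finset.sum_boole, hN, hF]
  have h2 : ∑ k ∈ S, ∑ l ∈ S.erase k, (if k ∈ C then (1 : ℝ≥0∞) else 0) * (if l ∈ C then 1 else 0) =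
      ((N * (N - 1) : ℕ) : ℝ≥0∞) := by
    have hk : ∀ k ∈ S, ∑ l ∈ S.erase k, (if k ∈ C then (1 : ℝ≥0∞) else 0) * (if l ∈ C then 1 else 0) =
        if k ∈ C then ((#((S.erase k).filter (· ∈ C)) : ℕ) : ℝ≥0∞) else 0 := by
      intro k _
      by_cases hkC : k ∈ C
      · simp only [if_pos hkC, one_mul, Finset.sum_boole]
      · simp only [if_neg hkC, zero_mul, Finset.sum_const_zero]
    rw [Finset.sum_congr rfl hk, ← Finset.sum_filter]
    have hk2 : ∀ k ∈ F, (((#((S.erase k).filter (· ∈ C)) : ℕ)) : ℝ≥0∞) = ((N - 1 : ℕ) : ℝ≥0∞) := by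
      intro k hkF
      rw [Finset.filter_erase, ← hF, Finset.card_erase_of_mem hkF]
    rw [Finset.sum_congr rfl hk2, Finset.sum_const, ← hN, nsmul_eq_mul]
    push_cast
    ring
  rw [h1, h2]
  obtain ⟨m, hm⟩ := hodd
  have hle : 3 * N ≤ 3 + N * (N - 1) := by
    rcases Nat.lt_or_ge m 1 with h0 | h0
    · have : m = 0 := by omega
      subst this; simp [hm]
    · have h3 : 3 ≤ N := by omega
      have : 3 * (N - 1) ≤ N * (N - 1) := Nat.mul_le_mul_right _ h3
      omega
  exact_mod_cast hle

/-- **Parity**: for `∂n₁ = Y ∋ y₁`, `∂n₂ = ∅`, the number of sources other than `y₁` in the cluster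
`C_{n₁+n₂}(y₁)` is odd (the cluster contains an even number of sources of `n₁ + n₂`, whose source set
is `Y`). [cite: DuminilCopin2016, §2.2] -/
theorem odd_card_erase_filter_mem_cluster {n₁ n₂ : Current G} {Y : Finset V} {y₁ : V} (hy : y₁ ∈ Y)
    (h1 : n₁.sources = Y) (h2 : n₂.sources = ∅) :
    Odd #((Y.erase y₁).filter (· ∈ (n₁ + n₂).cluster y₁)) := by
  classical
  have hev := even_card_sources_filter_reachable (n₁ + n₂) y₁
  rw [sources_add, h1, h2, show Y ∆ (∅ : Finset V) = Y from symmDiff_bot Y] at hev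
  have hfilt : Y.filter (fun u => (Percolation.openGraph (n₁ + n₂).traced).Reachable y₁ u) =
      Y.filter (· ∈ (n₁ + n₂).cluster y₁) :=
    Finset.filter_congr fun u _ => mem_cluster_iff.symm
  rw [hfilt] at hev
  have hins : Y.filter (· ∈ (n₁ + n₂).cluster y₁) =
      insert y₁ ((Y.erase y₁).filter (· ∈ (n₁ + n₂).cluster y₁)) := by
    conv_lhs => rw [← Finset.insert_erase hy]
    rw [Finset.filter_insert, if_pos (mem_cluster_self _ _)]
  rw [hins, Finset.card_insert_of_notMem (fun h => (Finset.mem_erase.1 (Finset.mem_filter.1 h).1).1 rfl)]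
    at hev
  rcases Nat.even_or_odd #((Y.erase y₁).filter (· ∈ (n₁ + n₂).cluster y₁)) with h | h
  · exact absurd hev (Nat.not_even_iff_odd.2 (Even.add_one h))
  · exact h

/-- **Two extra sources in the cluster, switched into a second current**: for `k, l` and the cluster
`C = C_{n₁+n₂}(y₁)` under sources `(Y, ∅)`,
`∑ 1{∂n₁=Y}1{∂n₂=∅} w w 1{k∈C}1{l∈C} = ∑ 1{∂n₁=YΔ{k}Δ{l}} 1{∂n₂={k,l}} w w 1{k ∈ C_{n₁+n₂}(y₁)}`.
[cite: Panis2023Triviality, Lemma 4.4] -/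
theorem tsum_epairWeight_two_indicators (hK : ∀ e, 0 ≤ K e) (Y : Finset V) (y₁ k l : V) :
    ∑' p : Current G × Current G, epairWeight K Y ∅ p *
        ((if k ∈ (p.1 + p.2).cluster y₁ then 1 else 0) * (if l ∈ (p.1 + p.2).cluster y₁ then 1 else 0)) =
      ∑' p : Current G × Current G, epairWeight K (Y ∆ ({k} ∆ {l})) ({k} ∆ {l}) p *
        (if k ∈ (p.1 + p.2).cluster y₁ then 1 else 0) := by
  rw [tsum_epairWeight_switch_pair hK Y k l (fun m => if k ∈ m.cluster y₁ then 1 else 0)]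
  refine tsum_congr fun p => ?_
  congr 1
  by_cases hk : k ∈ (p.1 + p.2).cluster y₁
  · have hiff : l ∈ (p.1 + p.2).cluster y₁ ↔ l ∈ (p.1 + p.2).cluster k :=
      ⟨fun hl => mem_cluster_trans (mem_cluster_comm.1 hk) hl, fun hl => mem_cluster_trans hk hl⟩
    by_cases hl : l ∈ (p.1 + p.2).cluster y₁
    · rw [if_pos hk, if_pos hl, if_pos (hiff.1 hl)]
    · rw [if_pos hk, if_neg hl, if_neg (fun h => hl (hiff.2 h))]
  · rw [if_neg hk, zero_mul, zero_mul]

/-- **The excess in the Gaussian step** (`y₁ ∈ Y`, `K ≥ 0`):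
`3 ∑_{j∈Y∖y₁} Z[YΔ{y₁}Δ{j}] Z[{y₁}Δ{j}] ≤ 3 Z[Y]Z[∅] + ∑_{k∈Y∖y₁} ∑_{l∈Y∖{y₁,k}} ∑ 1{∂n₁=YΔ{k}Δ{l}} 1{∂n₂={k,l}} w w 1{k ∈ C_{n₁+n₂}(y₁)}`:
each term on the left is `∑ 1{∂n₁=Y}1{∂n₂=∅} w w 1{j ∈ C(y₁)}` (one switching), the number `N` of such `j` is
odd (`odd_card_erase_filter_mem_cluster`), `3N ≤ 3 + N(N-1)`, and each ordered pair of them is switched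
into a second current (`tsum_epairWeight_two_indicators`). [cite: AizenmanCMP1982, Prop. 12.1] -/
theorem three_mul_gaussianDefect_le (hK : ∀ e, 0 ≤ K e) {Y : Finset V} {y₁ : V} (hy : y₁ ∈ Y) :
    3 * ∑ j ∈ Y.erase y₁, ecurrentSum K (Y ∆ ({y₁} ∆ {j})) * ecurrentSum K ({y₁} ∆ {j}) ≤
      3 * (ecurrentSum K Y * ecurrentSum K ∅) +
        ∑ k ∈ Y.erase y₁, ∑ l ∈ (Y.erase y₁).erase k,
          ∑' p : Current G × Current G, epairWeight K (Y ∆ ({k} ∆ {l})) ({k} ∆ {l}) p *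
            (if k ∈ (p.1 + p.2).cluster y₁ then 1 else 0) := by
  set S : Finset V := Y.erase y₁ with hS
  set E0 : Current G × Current G → ℝ≥0∞ := epairWeight K Y ∅ with hE0
  set C : Current G × Current G → Finset V := fun p => (p.1 + p.2).cluster y₁ with hC
  set ι : V → Current G × Current G → ℝ≥0∞ := fun j p => if j ∈ C p then 1 else 0 with hι
  -- the left side as one series
  have hL : ∑ j ∈ S, ecurrentSum K (Y ∆ ({y₁} ∆ {j})) * ecurrentSum K ({y₁} ∆ {j}) =
      ∑' p, E0 p * ∑ j ∈ S, ι j p := by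
    have hj : ∀ j, ecurrentSum K (Y ∆ ({y₁} ∆ {j})) * ecurrentSum K ({y₁} ∆ {j}) = ∑' p, E0 p * ι j p :=
      fun j => (tsum_epairWeight_empty_mul_indicator hK Y y₁ j).symm
    simp_rw [hj]
    rw [← Summable.tsum_finsetSum (fun _ _ => ENNReal.summable)]
    refine tsum_congr fun p => ?_
    rw [Finset.mul_sum]
  -- the right side as one series
  have hR : 3 * (ecurrentSum K Y * ecurrentSum K ∅) +
      ∑ k ∈ S, ∑ l ∈ S.erase k, ∑' p : Current G × Current G,
        epairWeight K (Y ∆ ({k} ∆ {l})) ({k} ∆ {l}) p * (if k ∈ (p.1 + p.2).cluster y₁ then 1 else 0) =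
      ∑' p, E0 p * (3 + ∑ k ∈ S, ∑ l ∈ S.erase k, ι k p * ι l p) := by
    have hkl : ∀ k l, ∑' p : Current G × Current G,
        epairWeight K (Y ∆ ({k} ∆ {l})) ({k} ∆ {l}) p * (if k ∈ (p.1 + p.2).cluster y₁ then 1 else 0) =
        ∑' p, E0 p * (ι k p * ι l p) := fun k l => (tsum_epairWeight_two_indicators hK Y y₁ k l).symm
    simp_rw [hkl]
    rw [← tsum_epairWeight K Y ∅]
    have hinner : ∀ k, ∑ l ∈ S.erase k, ∑' p, E0 p * (ι k p * ι l p) = ∑' p, E0 p * ∑ l ∈ S.erase k, ι k p * ι l p := by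
      intro k
      rw [← Summable.tsum_finsetSum (fun _ _ => ENNReal.summable)]
      refine tsum_congr fun p => ?_
      rw [Finset.mul_sum]
    simp_rw [hinner]
    rw [← Summable.tsum_finsetSum (fun _ _ => ENNReal.summable), ← ENNReal.tsum_mul_left, ← ENNReal.tsum_add]
    refine tsum_congr fun p => ?_
    rw [mul_add, Finset.mul_sum]
    ring
  rw [hL, hR, ← ENNReal.tsum_mul_left]
  refine ENNReal.tsum_le_tsum fun p => ?_
  rw [← mul_assoc, mul_comm 3 (E0 p), mul_assoc]
  by_cases hp : p.1.sources = Y ∧ p.2.sources = ∅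
  · refine mul_le_mul' le_rfl ?_
    exact three_mul_sum_indicator_le (odd_card_erase_filter_mem_cluster hy hp.1 hp.2)
  · simp only [hE0, epairWeight, if_neg hp, zero_mul, le_refl]

/-- **The excess in the Gaussian step is bounded by tree diagrams** (`y₁ ∈ Y`, `K ≥ 0`; the estimate of
each switched pair by `manySource_treeBound`):
`3 (∑_{j∈Y∖y₁} Z[YΔ{y₁}Δ{j}] Z[{y₁}Δ{j}]) Z[∅]³ ≤ 3 Z[Y] Z[∅]⁴
  + ∑_{k∈Y∖y₁} ∑_{l∈Y∖{y₁,k}} ∑_u ∑_{y ∈ (YΔ{k}Δ{l})∖y₁} Z[{k,u}]Z[{l,u}]Z[{y₁,u}]Z[{u,y}] Z[YΔ{k}Δ{l}Δ{y₁}Δ{y}]`.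
[cite: AizenmanCMP1982, Prop. 12.1 with Prop. 5.3] [cite: Panis2023Triviality, Prop. 4.6 and §4.2] -/
theorem three_mul_gaussianDefect_le_tree (hK : ∀ e, 0 ≤ K e) {Y : Finset V} {y₁ : V} (hy : y₁ ∈ Y) :
    3 * (∑ j ∈ Y.erase y₁, ecurrentSum K (Y ∆ ({y₁} ∆ {j})) * ecurrentSum K ({y₁} ∆ {j})) * ecurrentSum K ∅ ^ 3 ≤
      3 * (ecurrentSum K Y * ecurrentSum K ∅ ^ 4) +
        ∑ k ∈ Y.erase y₁, ∑ l ∈ (Y.erase y₁).erase k, ∑ u, ∑ y ∈ (Y ∆ ({k} ∆ {l})).erase y₁,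
          ecurrentSum K ({k} ∆ {u}) * ecurrentSum K ({l} ∆ {u}) * ecurrentSum K ({y₁} ∆ {u}) *
            (ecurrentSum K ({u} ∆ {y}) * ecurrentSum K ((Y ∆ ({k} ∆ {l})) ∆ ({y₁} ∆ {y}))) := by
  have h1 := three_mul_gaussianDefect_le hK hy
  have hmem : ∀ k ∈ Y.erase y₁, ∀ l ∈ (Y.erase y₁).erase k, y₁ ∈ Y ∆ ({k} ∆ {l}) := by
    intro k hk l hl
    have hk1 : k ≠ y₁ := (Finset.mem_erase.1 hk).1
    have hl1 : l ≠ y₁ := (Finset.mem_erase.1 (Finset.mem_erase.1 hl).2).1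
    rw [Finset.mem_symmDiff]
    refine Or.inl ⟨hy, fun h => ?_⟩
    rcases eq_or_eq_of_mem_symmDiff_singleton h with h | h
    · exact hk1 h.symm
    · exact hl1 h.symm
  calc 3 * (∑ j ∈ Y.erase y₁, ecurrentSum K (Y ∆ ({y₁} ∆ {j})) * ecurrentSum K ({y₁} ∆ {j})) *
        ecurrentSum K ∅ ^ 3
      ≤ (3 * (ecurrentSum K Y * ecurrentSum K ∅) +
          ∑ k ∈ Y.erase y₁, ∑ l ∈ (Y.erase y₁).erase k,
            ∑' p : Current G × Current G, epairWeight K (Y ∆ ({k} ∆ {l})) ({k} ∆ {l}) p *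
              (if k ∈ (p.1 + p.2).cluster y₁ then 1 else 0)) * ecurrentSum K ∅ ^ 3 :=
        mul_le_mul' h1 le_rfl
    _ = 3 * (ecurrentSum K Y * ecurrentSum K ∅ ^ 4) +
          ∑ k ∈ Y.erase y₁, ∑ l ∈ (Y.erase y₁).erase k,
            (∑' p : Current G × Current G, epairWeight K (Y ∆ ({k} ∆ {l})) ({k} ∆ {l}) p *
              (if k ∈ (p.1 + p.2).cluster y₁ then 1 else 0)) * ecurrentSum K ∅ ^ 3 := by
        rw [add_mul, Finset.sum_mul]
        congr 1
        · ring
        · exact Finset.sum_congr rfl fun k _ => Finset.sum_mul _ _ _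
    _ ≤ _ := by
        gcongr with k hk l hl
        exact manySource_treeBound hK (hmem k hk l hl) k l

end Current

end Literature.Probability.LatticeModels

end
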